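import Literature.Computability.Complexity.EasyWitnessProofs
import Literature.Computability.Complexity.CircuitSizeProofs
import Literature.Computability.Complexity.CircuitLowerBounds
import Literature.Computability.Complexity.PolyAdviceClosure
import HarnessLib

/-!
# The easy witness method: IKW Lemma 5 from a universal language for `NTIME(2ⁿ)`

Second proof companion of `EasyWitness.lean`. IKW's Lemma 5 — "if `NEXP ⊂ P/poly`, then there
is a fixed constant `d₀` such that `NTIME(2ⁿ)/n ⊂ SIZE(n^{d₀})`", the named fact
`IKW2002_lemma5` — is proved in the source in two moves: (U) the universal nondeterministic
machine `U` ("on input `(i, x)` of size `n` … runs in time `2^{2n}`, simulating the `i`th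
nondeterministic Turing machine `Mᵢ` on input `x`") has its language in `NEXP`, hence in
`P/poly` with circuits of some size `n^k`; (H) hardwiring the constant-size code `i` and the
linear-size advice into those circuits decides every `L ∈ NTIME(2ⁿ)/n` by circuits of size
`O(n^k) ≤ n^{k+1}` at every large length. Move (H) is circuit bookkeeping that the tree can do
(`exists_cktSize_boolPair_of_mem_PPoly`, `cktSize_pairVec`, `CktSize.hardwire` of
`CircuitClassesProofs.lean`); move (U) is an efficient clocked universal machine in Mathlib's
`TM2` model, which the tree records as the named fact
`Literature.Computability.MetaComplexity.UniversalMachine.clockedUniversalSimulation`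
(Arora–Barak Thm. 1.9) and has not constructed. Accordingly:

* `exists_NEXP_universal_for_NTIME_two_pow` — NAMED FACT (U): a language `K ∈ NEXP` to which
  every `L' ∈ NTIME(2ⁿ)` reduces by prefixing a code, `x ∈ L' ↔ ⟨e, x⟩ ∈ K` for all long `x`
  (IKW, proof of Lemma 5; the universal NDTM of Arora–Barak §2.1.2 / Exercise 2.6, clocked);
* `cktSize_hardwire_code_advice` — PROVED (H): circuits for `x ↦ [⟨e, ⟨x, a⟩⟩ ∈ K]` of size
  `N + (2|e| + 2 + N) + q(2|e| + 2 + N) + 2`, `N = 2n + 2 + |a|`, from size-`q` circuits for `K`;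
* `IKW2002_lemma5_of_universal` — PROVED: (U) implies `IKW2002_lemma5`, with
  `d₀ = deg q + 2` for the size polynomial `q` of `K ∈ P/poly`;
* `NEXP_eq_EXP_of_subset_PPoly_of_IKW₂U` — the fact `NEXP_eq_EXP_of_subset_PPoly` on the trust
  base {`EXP_eq_MA_of_subset_PPoly` (IKW Thm. 22), `IKW2002_thm18_MA` (IKW Thm. 18), (U)}.

## References

* R. Impagliazzo, V. Kabanets, A. Wigderson, *In search of an easy witness: exponential time vs.
  probabilistic polynomial time*, JCSS 65 (2002) 672–694, Lemma 5 and its proof, Thm. 24.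
* S. Arora, B. Barak, *Computational Complexity: A Modern Approach*, CUP 2009, Thm. 1.9 and
  §1.4.1 (efficient/clocked universal TM), §2.1.2 and Exercise 2.6 (universal NDTM), Thm. 6.18
  and Thm. 7.14 (hardwiring advice into circuits), Lemma 20.20.
-/

noncomputable section

namespace Literature.Computability.Complexity

open Filter Polynomial

/-! ### The universal language (named fact) -/

/-- **A universal language for `NTIME(2ⁿ)` inside `NEXP`.** IKW, proof of Lemma 5: "Consider the
following nondeterministic Turing machine `U`. On input `(i, x)` of size `n`, where `i ∈ ℕ` and
`x ∈ {0,1}*`, the machine `U` runs in time `2^{2n}`, simulating the `i`th nondeterministic Turing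
machine `Mᵢ` on input `x`; the machine `U` accepts iff `Mᵢ` accepts" — so the language `K` of `U`
is in `NEXP`, and every `L' ∈ NTIME(2ⁿ)`, decided by some `Mᵢ` in time `O(2ⁿ)`, satisfies
`x ∈ L' ↔ (i, x) ∈ K` as soon as the clock `2^{2n}` covers the simulation of `Mᵢ` (all
sufficiently long `x`). The universal nondeterministic machine is Arora–Barak §2.1.2 ("there
exists a universal nondeterministic Turing machine", Exercise 2.6, with the efficient simulation of
Thm. 1.9). Rendering: `K ∈ NEXP`; the pair `(i, x)` is `boolPair e x` for a code word `e`
depending on `L'` only; "for all sufficiently long `x`" is `∀ᶠ n in atTop` over the length.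
Named fact: over Mathlib's `TM2` machines it needs the clocked efficient universal machine
(`Literature.Computability.MetaComplexity.UniversalMachine.clockedUniversalSimulation`) run
behind an exponential witness clock (cf. `padPre_mem_NTIME_two_pow`, `NTIMEPadding.lean`).
[cite: ImpagliazzoKabanetsWigderson2002, Lemma 5 (proof)]
[cite: AroraBarakCC2009, §2.1.2 and Exercise 2.6] -/
def exists_NEXP_universal_for_NTIME_two_pow : Prop :=
  ∃ K ∈ NEXP, ∀ L' ∈ NTIME (fun n => 2 ^ n), ∃ e : List Bool,
    ∀ᶠ n in atTop, ∀ x : List Bool, x.length = n → (x ∈ L' ↔ boolPair e x ∈ K)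

/-! ### Hardwiring code and advice (proved) -/

/-- **Hardwiring the code and the advice** (IKW, proof of Lemma 5: "every language
`L ∈ NTIME(2ⁿ)/n` can be decided by Boolean circuits of size `O((2n)^k)`"; Arora–Barak, proof of
Thm. 6.18 / Thm. 7.14, "hardwire such a string"): from `B₂`-circuits of size `M + q(M)` for
`(u, v) ↦ [⟨u, v⟩ ∈ K]` on `M = 2|u| + 2 + |v|` wires (`exists_cktSize_boolPair_of_mem_PPoly`)
one gets, for fixed strings `e`, `a`, circuits for `x ↦ [⟨e, ⟨x, a⟩⟩ ∈ K]` on `n` wires of size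
`N + ((2|e| + 2 + N) + q(2|e| + 2 + N)) + 2`, `N = 2n + 2 + |a|` (inner pairing `cktSize_pairVec`,
then the `K`-circuit, then two constant gates feeding the hardwired positions).
[cite: ImpagliazzoKabanetsWigderson2002, Lemma 5 (proof)] [cite: AroraBarakCC2009, Thm. 6.18] -/
theorem cktSize_hardwire_code_advice {K : Language Bool} {q : Polynomial ℕ}
    (hq : ∀ k N : ℕ, CktSize B2 (fun (w : Fin k ⊕ Fin N → Bool) (_ : Unit) =>
      K.boolIndicator (boolPair (List.ofFn fun i => w (.inl i)) (List.ofFn fun j => w (.inr j))))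
      ((2 * k + 2 + N) + q.eval (2 * k + 2 + N)))
    (e a : List Bool) (n : ℕ) :
    CktSize B2 (fun (x : Fin n → Bool) (_ : Unit) =>
        K.boolIndicator (boolPair e (boolPair (List.ofFn x) a)))
      ((2 * n + 2 + a.length) + ((2 * e.length + 2 + (2 * n + 2 + a.length)) +
        q.eval (2 * e.length + 2 + (2 * n + 2 + a.length))) + 2) := by
  -- inner pairing `(x, a) ↦ pairVec x a`, carried along with the code wires
  have h1 : CktSize B2 (fun (v : (Fin n ⊕ Fin a.length) ⊕ Fin e.length → Bool) =>
      Sum.elim (fun i : Fin e.length => v (.inr i))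
        (pairVec (fun i => v (.inl (.inl i))) (fun j => v (.inl (.inr j)))))
      (0 + (2 * n + 2 + a.length)) :=
    (CktSize.proj B2 fun i : Fin e.length =>
        (Sum.inr i : (Fin n ⊕ Fin a.length) ⊕ Fin e.length)).pair
      ((cktSize_pairVec n a.length).rewire
        fun i : Fin n ⊕ Fin a.length => (Sum.inl i : (Fin n ⊕ Fin a.length) ⊕ Fin e.length))
  have h3 := h1.comp (hq e.length (2 * n + 2 + a.length))
  -- regroup the variables as `x ⊕ (a ⊕ e)` and hardwire `a`, `e`
  have h4 := (h3.rewire (ι' := Fin n ⊕ (Fin a.length ⊕ Fin e.length))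
    (Sum.elim (Sum.elim (fun i => Sum.inl i) (fun j => Sum.inr (Sum.inl j)))
      fun k => Sum.inr (Sum.inr k))).hardwire (Sum.elim a.get e.get)
  refine (h4.of_le (by omega)).congr fun x u => ?_
  simp only [Sum.elim_inl, Sum.elim_inr]
  rw [List.ofFn_get, ofFn_pairVec, List.ofFn_get]

/-! ### Lemma 5 from the universal language -/

/-- **IKW Lemma 5 from the universal language**: if `NEXP ⊆ P/poly` then, with `K ∈ P/poly` the
universal language of `exists_NEXP_universal_for_NTIME_two_pow` and `q` its size polynomial on
pairs, every `L ∈ NTIME(2ⁿ)/n` — `x ∈ L ↔ ⟨x, a(|x|)⟩ ∈ L'`, `|a(n)| ≤ cn + c`, `L' ∈ NTIME(2ⁿ)`,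
`w ∈ L' ↔ ⟨e, w⟩ ∈ K` for long `w` — has, at every large length `n`, the circuit of
`cktSize_hardwire_code_advice`, of size `≤ 3m + q(m) + 2` with `m = 2|e| + 4 + 2n + |a(n)|
≤ (c + 3)n`, hence `≤ q(1)(c+3)^{deg q} n^{deg q} + (3c + 11)n ≤ n^{deg q + 2}`: the printed
"circuits of size `O((2n)^k)`, which is in `O(n^k)` … take `d₀ = k + 1`", with the tree's
`circuitSize` and one more power absorbing the constant. So `d₀ = deg q + 2` serves for the whole
class. [cite: ImpagliazzoKabanetsWigderson2002, Lemma 5] -/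
theorem IKW2002_lemma5_of_universal (hU : exists_NEXP_universal_for_NTIME_two_pow) :
    IKW2002_lemma5 := by
  intro hNP
  obtain ⟨K, hK, hKu⟩ := hU
  obtain ⟨q, hq⟩ := exists_cktSize_boolPair_of_mem_PPoly (hNP hK)
  refine ⟨q.natDegree + 2, ?_⟩
  rintro L ⟨L', hL', c, a, ha, hL⟩
  obtain ⟨e, he⟩ := hKu L' hL'
  obtain ⟨M₀, hM₀⟩ := eventually_atTop.1 he
  set d := q.natDegree with hd
  set A := q.eval 1 * (c + 3) ^ d with hA
  refine eventually_atTop.2 ⟨M₀ + A + 2 * e.length + 5 * c + 12, fun n hn => ?_⟩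
  -- the circuit at length `n` computes the slice of `L`
  obtain ⟨C, hCB, hCs, hCe⟩ := (cktSize_hardwire_code_advice hq e (a n) n).toCircuit
  have hcomp : C.Computes (L.sliceFn n) := by
    intro x
    rw [hCe x]
    change K.boolIndicator _ = L.boolIndicator (List.ofFn x)
    refine (boolIndicator_eq_of_iff ?_).symm
    rw [hL (List.ofFn x), List.length_ofFn]
    refine hM₀ (boolPair (List.ofFn x) (a n)).length ?_ _ rfl
    simp only [length_boolPair, List.length_ofFn]
    omega
  refine (circuitSizeOver_le_of_computes C hCB hcomp).trans (hCs.trans ?_)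
  -- size arithmetic
  set m := 2 * e.length + 2 + (2 * n + 2 + (a n).length) with hm
  have han : (a n).length ≤ c * n + c := ha n
  have hn1 : 1 ≤ n := by omega
  have hm1 : m ≤ (c + 3) * n := by nlinarith
  have hmq : q.eval m ≤ A * n ^ d := by
    calc q.eval m ≤ q.eval 1 * m ^ d := natPoly_eval_le_eval_one_mul_pow q (by omega)
      _ ≤ q.eval 1 * ((c + 3) * n) ^ d := Nat.mul_le_mul_left _ (Nat.pow_le_pow_left hm1 d)
      _ = A * n ^ d := by rw [hA, mul_pow, mul_assoc]
  have p1 : n ^ d ≤ n ^ (d + 1) := Nat.pow_le_pow_right hn1 (by omega)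
  have p2 : n ≤ n ^ (d + 1) := by
    calc n = n ^ 1 := (pow_one n).symm
      _ ≤ n ^ (d + 1) := Nat.pow_le_pow_right hn1 (by omega)
  have q1 : A * n ^ d ≤ A * n ^ (d + 1) := Nat.mul_le_mul_left _ p1
  have q2 : (3 * c + 11) * n ≤ (3 * c + 11) * n ^ (d + 1) := Nat.mul_le_mul_left _ p2
  have q3 : (A + 3 * c + 11) * n ^ (d + 1) ≤ n * n ^ (d + 1) :=
    Nat.mul_le_mul_right _ (by omega)
  have e3 : n * n ^ (d + 1) = n ^ (d + 2) := by ring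
  have hsum : 2 * n + 2 + (a n).length + (m + q.eval m) + 2 ≤ A * n ^ d + (3 * c + 11) * n := by
    nlinarith
  calc 2 * n + 2 + (a n).length + (m + q.eval m) + 2 ≤ A * n ^ d + (3 * c + 11) * n := hsum
    _ ≤ A * n ^ (d + 1) + (3 * c + 11) * n ^ (d + 1) := Nat.add_le_add q1 q2
    _ = (A + 3 * c + 11) * n ^ (d + 1) := by ring
    _ ≤ n * n ^ (d + 1) := q3
    _ = n ^ (d + 2) := e3

/-- **IKW Theorem 24 / Arora–Barak Lemma 20.20 on the trust base {Thm. 22, Thm. 18 (`MA` case),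
universal language}**: `NEXP ⊆ P/poly ⟹ NEXP = EXP` from `EXP_eq_MA_of_subset_PPoly`,
`IKW2002_thm18_MA` and `exists_NEXP_universal_for_NTIME_two_pow` (Lemma 5 by
`IKW2002_lemma5_of_universal`, Thm. 2 by `IKW2002_thm2_holds`).
[cite: ImpagliazzoKabanetsWigderson2002, Thm. 24] [cite: AroraBarakCC2009, Lemma 20.20 (p. 417)] -/
theorem NEXP_eq_EXP_of_subset_PPoly_of_IKW₂U (h22 : EXP_eq_MA_of_subset_PPoly)
    (h18 : IKW2002_thm18_MA) (hU : exists_NEXP_universal_for_NTIME_two_pow) :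
    NEXP_eq_EXP_of_subset_PPoly :=
  NEXP_eq_EXP_of_subset_PPoly_of_IKW₃ h22 h18 (IKW2002_lemma5_of_universal hU)

end Literature.Computability.Complexity

end
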